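import Mathlib.FieldTheory.IsAlgClosed.AlgebraicClosure
import Mathlib.GroupTheory.FreeGroup.Reduce
import Mathlib.LinearAlgebra.Matrix.Charpoly.Coeff
import Literature.NumberTheory.GaloisRepresentations.TwistedSumDecomposition
import Literature.NumberTheory.GaloisRepresentations.TwistedSumAssembly
import HarnessLib

/-!
# HLTT Prop. 7.12 as literally printed is false: a counterexample to `prop712`

`Literature.NumberTheory.GaloisRepresentations.HarrisLanTaylorThorne2016.prop712` transcribes
Harris–Lan–Taylor–Thorne, Res. Math. Sci. 3:37 (2016), Prop. 7.12 (p. 232) with the setting of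
p. 225 *verbatim*: "`k` an algebraically closed, topological field of characteristic `0`", no
separation axiom.  The printed proof, however, uses that `k` is Hausdorff: p. 226, l. 8, "Note
that `ρ_M(𝔉)` is Zariski dense in `G_M`" (density of `𝔉` in `Γ` passes to Zariski density of
its image only if Zariski-closed sets of `k`-points are closed for the topology of `k`, i.e.
`{0}` is closed in `k`), and Thm. 7.13 applies the proposition with `k = ℚ̄_p`.  This file proves
that the literal statement is false,

* `HarrisLanTaylorThorne2016.not_prop712 : ¬ prop712`,

so that the corrected named fact `prop712Hausdorff` (same file as `prop712`, hypothesis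
`[T2Space k]` added) is the one to use; and it **discharges** that corrected fact,

* `HarrisLanTaylorThorne2016.prop712Hausdorff_holds : prop712Hausdorff`

(last section; the proof, assembled in `TwistedSumAssembly`, replaces the algebraic-group
argument of the source by character theory — Brauer–Nesbitt for semisimple representations —,
multiplicities of twists and the combinatorial lemma of `TwistedSumCombinatorics`; see the
section docstring below and the module docstrings of `TwistedSumAlgebraic`,
`TwistedSumAssembly`).

The counterexample (`namespace Prop712Counterexample`).  `Γ₀ = F_2 = ⟨a, b⟩` (`FreeGroup Bool`)
and `k₀ = ℚ̄` (`AlgebraicClosure ℚ`), both with the **indiscrete** topology, so that every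
homomorphism is continuous and the finite set `𝔉 = {a, b, ab}` is dense; `d = 1`;
`μ(a) = μ(b) = 2` (infinite order at `a, b, ab`); `𝔈¹_f = 𝔈²_f = {1}` for `f = a, b` and `{-1}`
for `f = ab`; `ℳ = ℤ_{>0}`; for `N ≥ 1`, with `Q = 2^N`, `u = -(Q² + Q + 2)/(Q - 1)`,
`p = 1 + Q - u`, `s = pu - Q ≠ 0`,
`ρ_N(a) = A = diag(1, Q)`, `ρ_N(b) = B = (p 1; s u)`: `tr A = tr B = 1 + Q`, `det A = det B = Q`,
`tr AB = -1 - Q²`, `det AB = Q²`, so the roots of the characteristic polynomials at `a, b, ab` are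
`{1} ⊔ {1}·μ^N`, `{1} ⊔ {1}·μ^N`, `{-1} ⊔ {-1}·μ(ab)^N`, and `ρ_N` is irreducible (`A` has the two
eigenlines `k e₁, k e₂`, `B` fixes neither since its off-diagonal entries `1, s` are non-zero),
hence semisimple.  A `ρ¹ : Γ₀ → GL_1(k₀)` as in the conclusion would be a character with
`ρ¹(a) = ρ¹(b) = 1` and `ρ¹(ab) = -1`, absurd.  Everything is elementary linear algebra over
Mathlib (`Matrix.charpoly_fin_two`, `Representation.IsIrreducible` as `IsSimpleOrder` of the
subrepresentation lattice).

## References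

* M. Harris, K.-W. Lan, R. Taylor, J. Thorne, *On the rigid cohomology of certain Shimura
  varieties*, Res. Math. Sci. 3:37 (2016), §7, pp. 225–226 and Prop. 7.12 (p. 232).
  [HarrisLanTaylorThorneRMS2016]
-/

noncomputable section

open Polynomial Matrix

namespace Literature.NumberTheory.GaloisRepresentations.HarrisLanTaylorThorne2016

namespace Prop712Counterexample

/-- The group of the counterexample: the free group on two letters (as a type synonym, to carry
the indiscrete topology). [folklore] -/
def Γ₀ : Type := FreeGroup Bool

/-- `Γ₀` is a group (the free group structure). [folklore] -/
instance : Group Γ₀ := inferInstanceAs (Group (FreeGroup Bool))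

/-- The indiscrete topology on `Γ₀`. [folklore] -/
instance : TopologicalSpace Γ₀ := ⊤

/-- Any group is a topological group for the indiscrete topology. [folklore] -/
instance : IsTopologicalGroup Γ₀ where
  continuous_mul := continuous_top
  continuous_inv := continuous_top

/-- The first free generator `a`. [folklore] -/
def a : Γ₀ := FreeGroup.of true

/-- The second free generator `b`. [folklore] -/
def b : Γ₀ := FreeGroup.of false

/-- The field of the counterexample: `ℚ̄` (as a type synonym, to carry the indiscrete topology;
any algebraically closed field of characteristic `0` would do). [folklore] -/
def k₀ : Type := AlgebraicClosure ℚ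

/-- `k₀ = ℚ̄` is a field. [folklore] -/
instance : Field k₀ := inferInstanceAs (Field (AlgebraicClosure ℚ))

/-- `k₀ = ℚ̄` is algebraically closed. [folklore] -/
instance : IsAlgClosed k₀ := inferInstanceAs (IsAlgClosed (AlgebraicClosure ℚ))

/-- `k₀ = ℚ̄` has characteristic `0`. [folklore] -/
instance : CharZero k₀ := inferInstanceAs (CharZero (AlgebraicClosure ℚ))

/-- The indiscrete topology on `k₀`. [folklore] -/
instance : TopologicalSpace k₀ := ⊤

/-- Any field is a topological field for the indiscrete topology. [folklore] -/
instance : IsTopologicalDivisionRing k₀ where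
  continuous_add := continuous_top
  continuous_mul := continuous_top
  continuous_neg := continuous_top
  continuousAt_inv₀ _ _ := continuous_top.continuousAt

/-- Every map into `GL_n(k₀)` is continuous (`k₀` indiscrete). [folklore] -/
theorem continuous_to_GL {X : Type*} [TopologicalSpace X] {n : ℕ} (f : X → GL (Fin n) k₀) :
    Continuous f :=
  Units.continuous_iff.2 ⟨continuous_matrix fun _ _ => continuous_top,
    continuous_matrix fun _ _ => continuous_top⟩

/-- The unit `2 ∈ k₀^×`. [folklore] -/
def two : k₀ˣ := Units.mk0 2 two_ne_zero

/-- `μ : Γ₀ → k₀^×`, `a, b ↦ 2` (continuous as `k₀` is indiscrete). [folklore] -/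
def μ : Γ₀ →ₜ* k₀ˣ :=
  ⟨FreeGroup.lift fun _ => two, Units.continuous_iff.2 ⟨continuous_top, continuous_top⟩⟩

/-- `μ` of a generator is `2`. [folklore] -/
theorem μ_of (c : Bool) : μ (FreeGroup.of c) = two := by
  change FreeGroup.lift (fun _ => two) (FreeGroup.of c) = two
  rw [FreeGroup.lift_apply_of]

/-- `↑two = 2`. [folklore] -/
theorem val_two : ((two : k₀ˣ) : k₀) = 2 := Units.val_mk0 _

/-- `Q N = 2 ^ N`, the value `μ(a)^N = μ(b)^N`. [folklore] -/
def Q (N : ℕ) : k₀ := 2 ^ N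

/-- The `(1,1)` entry `u = -(Q² + Q + 2)/(Q - 1)` of `B`. [folklore] -/
def uu (N : ℕ) : k₀ := -(Q N ^ 2 + Q N + 2) / (Q N - 1)

/-- The `(0,0)` entry `p = 1 + Q - u` of `B` (so `tr B = 1 + Q`). [folklore] -/
def pp (N : ℕ) : k₀ := 1 + Q N - uu N

/-- The `(1,0)` entry `s = pu - Q` of `B` (so `det B = Q`). [folklore] -/
def ss (N : ℕ) : k₀ := pp N * uu N - Q N

/-- `A = ρ_N(a) = diag(1, Q)`. [folklore] -/
def A (N : ℕ) : Matrix (Fin 2) (Fin 2) k₀ := !![1, 0; 0, Q N]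

/-- `B = ρ_N(b) = (p 1; s u)`. [folklore] -/
def B (N : ℕ) : Matrix (Fin 2) (Fin 2) k₀ := !![pp N, 1; ss N, uu N]

/-- `det A = Q`. [folklore] -/
theorem det_A (N : ℕ) : (A N).det = Q N := by simp [A, Matrix.det_fin_two_of]

/-- `det B = Q`. [folklore] -/
theorem det_B (N : ℕ) : (B N).det = Q N := by simp [B, Matrix.det_fin_two_of, ss]

/-- `ρ_N : Γ₀ → GL_2(k₀)`, `a ↦ A`, `b ↦ B` (continuous as `k₀` is indiscrete). [folklore] -/
def ρN (N : ℕ) : FramedRep Γ₀ k₀ 2 :=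
  ⟨FreeGroup.lift fun c => cond c
      (Matrix.GeneralLinearGroup.mkOfDetNeZero (A N)
        (by rw [det_A]; exact pow_ne_zero _ two_ne_zero))
      (Matrix.GeneralLinearGroup.mkOfDetNeZero (B N)
        (by rw [det_B]; exact pow_ne_zero _ two_ne_zero)),
    continuous_to_GL _⟩

/-- `ρ_N(a) = A` as a matrix. [folklore] -/
theorem ρN_a (N : ℕ) : ((ρN N a : GL (Fin 2) k₀) : Matrix (Fin 2) (Fin 2) k₀) = A N := by
  change ((FreeGroup.lift _ (FreeGroup.of true) : GL (Fin 2) k₀) : Matrix (Fin 2) (Fin 2) k₀) = _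
  rw [FreeGroup.lift_apply_of]; rfl

/-- `ρ_N(b) = B` as a matrix. [folklore] -/
theorem ρN_b (N : ℕ) : ((ρN N b : GL (Fin 2) k₀) : Matrix (Fin 2) (Fin 2) k₀) = B N := by
  change ((FreeGroup.lift _ (FreeGroup.of false) : GL (Fin 2) k₀) : Matrix (Fin 2) (Fin 2) k₀) = _
  rw [FreeGroup.lift_apply_of]; rfl

/-- `Q ≠ 1` for `N ≥ 1`. [folklore] -/
theorem Q_sub_one_ne_zero {N : ℕ} (hN : 1 ≤ N) : Q N - 1 ≠ 0 := by
  have h : (2 : ℕ) ^ N ≠ 1 := (Nat.one_lt_two_pow_iff.2 (by omega)).ne'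
  have h' : Q N ≠ 1 := by unfold Q; exact_mod_cast h
  exact sub_ne_zero.2 h'

/-- `Q ≠ -1`. [folklore] -/
theorem Q_add_one_ne_zero (N : ℕ) : Q N + 1 ≠ 0 := by
  have h : (2 : ℕ) ^ N + 1 ≠ 0 := Nat.succ_ne_zero _
  unfold Q; exact_mod_cast h

/-- `Q² ≠ -1`. [folklore] -/
theorem Q_sq_add_one_ne_zero (N : ℕ) : Q N ^ 2 + 1 ≠ 0 := by
  have h : ((2 : ℕ) ^ N) ^ 2 + 1 ≠ 0 := Nat.succ_ne_zero _
  unfold Q; exact_mod_cast h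

/-- The defining relation `u (Q - 1) = -(Q² + Q + 2)`. [folklore] -/
theorem uu_mul {N : ℕ} (hN : 1 ≤ N) : uu N * (Q N - 1) = -(Q N ^ 2 + Q N + 2) := by
  unfold uu; exact div_mul_cancel₀ _ (Q_sub_one_ne_zero hN)

/-- `s ≠ 0`: otherwise `p, u` are the roots `1, Q` of `x² - (1 + Q)x + Q`, and `u = 1` forces
`(Q + 1)² = 0`, `u = Q` forces `2(Q² + 1) = 0`. [folklore] -/
theorem ss_ne_zero {N : ℕ} (hN : 1 ≤ N) : ss N ≠ 0 := by
  intro hs0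
  have hu := uu_mul hN
  have hpu : pp N + uu N = 1 + Q N := by unfold pp; ring
  have hs0' : pp N * uu N - Q N = 0 := hs0
  have hfac : (uu N - 1) * (uu N - Q N) = 0 := by
    linear_combination (-1 : k₀) * hs0' + uu N * hpu
  rcases mul_eq_zero.1 hfac with h1 | h2
  · rw [sub_eq_zero.1 h1] at hu
    have : (Q N + 1) ^ 2 = 0 := by linear_combination hu
    exact Q_add_one_ne_zero N (pow_eq_zero_iff two_ne_zero |>.1 this)
  · rw [sub_eq_zero.1 h2] at hu
    have : (2 : k₀) * (Q N ^ 2 + 1) = 0 := by linear_combination hu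
    rcases mul_eq_zero.1 this with h | h
    · exact two_ne_zero h
    · exact Q_sq_add_one_ne_zero N h

/-- Roots of the characteristic polynomial of a `2 × 2` matrix from its trace and determinant.
[folklore] -/
theorem roots_charpoly_of_trace_of_det {M : Matrix (Fin 2) (Fin 2) k₀} {α β : k₀}
    (htr : M.trace = α + β) (hdet : M.det = α * β) : M.charpoly.roots = {α} + {β} := by
  have h : M.charpoly = (X - C α) * (X - C β) := by
    rw [Matrix.charpoly_fin_two, htr, hdet, C_add, C_mul]; ring
  rw [h, roots_mul (mul_ne_zero (X_sub_C_ne_zero α) (X_sub_C_ne_zero β)), roots_X_sub_C,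
    roots_X_sub_C]

/-- Roots of the characteristic polynomial of a `1 × 1` matrix. [folklore] -/
theorem roots_charpoly_fin_one (M : Matrix (Fin 1) (Fin 1) k₀) : M.charpoly.roots = {M 0 0} := by
  have h : M.charpoly = X - C (M 0 0) := by
    rw [Matrix.charpoly, Matrix.det_fin_one, Matrix.charmatrix_apply_eq]
  rw [h, roots_X_sub_C]

/-- `tr A = 1 + Q`. [folklore] -/
theorem trace_A (N : ℕ) : (A N).trace = 1 + Q N := by simp [A, Matrix.trace_fin_two]

/-- `tr B = 1 + Q`. [folklore] -/
theorem trace_B (N : ℕ) : (B N).trace = 1 + Q N := by simp [B, Matrix.trace_fin_two, pp]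

/-- `tr AB = p + Q u = -1 - Q²` (this is what `u` was chosen for). [folklore] -/
theorem trace_AB {N : ℕ} (hN : 1 ≤ N) : (A N * B N).trace = -1 + -(Q N ^ 2) := by
  have hu := uu_mul hN
  have h1 : (A N * B N).trace = pp N + Q N * uu N := by simp [A, B, Matrix.trace_fin_two]
  rw [h1]; unfold pp; linear_combination hu

/-- `det AB = Q²`. [folklore] -/
theorem det_AB (N : ℕ) : (A N * B N).det = -1 * -(Q N ^ 2) := by
  rw [Matrix.det_mul, det_A, det_B]; ring

/-- The first standard basis vector of `k₀²`. [folklore] -/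
def e₁ : Fin 2 → k₀ := ![1, 0]

/-- The second standard basis vector of `k₀²`. [folklore] -/
def e₂ : Fin 2 → k₀ := ![0, 1]

/-- `A w = (w₀, Q w₁)`. [folklore] -/
theorem A_mulVec (N : ℕ) (w : Fin 2 → k₀) : A N *ᵥ w = ![w 0, Q N * w 1] := by
  ext i; fin_cases i <;> simp [A, Matrix.mulVec, dotProduct, Fin.sum_univ_two]

/-- `B w = (p w₀ + w₁, s w₀ + u w₁)`. [folklore] -/
theorem B_mulVec (N : ℕ) (w : Fin 2 → k₀) :
    B N *ᵥ w = ![pp N * w 0 + w 1, ss N * w 0 + uu N * w 1] := by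
  ext i; fin_cases i <;> simp [B, Matrix.mulVec, dotProduct, Fin.sum_univ_two]

/-- `ρ_N` is irreducible for `N ≥ 1`: a non-zero invariant subspace `W` contains, with
`v ≠ 0`, the vectors `Q v - A v = (Q - 1) v₀ e₁` and `v` itself, hence `e₁` or `e₂`; and
`B e₁ - p e₁ = s e₂` (`s ≠ 0`), `B e₂ - u e₂ = e₁`, so `W ∋ e₁, e₂`, `W = k₀²`. [folklore] -/
theorem isIrreducible_ρN {N : ℕ} (hN : 1 ≤ N) : (ρN N).toRepresentation.IsIrreducible := by
  haveI : Nontrivial (Subrepresentation (ρN N).toRepresentation) :=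
    ⟨⟨⊥, ⊤, fun h => bot_ne_top (congrArg Subrepresentation.toSubmodule h)⟩⟩
  refine IsSimpleOrder.of_forall_eq_top fun W hW => ?_
  apply Subrepresentation.toSubmodule_injective
  change W.toSubmodule = ⊤
  have hSb : W.toSubmodule ≠ ⊥ := fun h => hW (Subrepresentation.toSubmodule_injective h)
  obtain ⟨v, hv, hv0⟩ := (Submodule.ne_bot_iff W.toSubmodule).1 hSb
  have hA : ∀ w ∈ W.toSubmodule, A N *ᵥ w ∈ W.toSubmodule := fun w hw => by
    simpa [ρN_a] using W.apply_mem_toSubmodule a hw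
  have hB : ∀ w ∈ W.toSubmodule, B N *ᵥ w ∈ W.toSubmodule := fun w hw => by
    simpa [ρN_b] using W.apply_mem_toSubmodule b hw
  have h12 : e₁ ∈ W.toSubmodule → e₂ ∈ W.toSubmodule := fun h1 => by
    have h := W.toSubmodule.sub_mem (hB _ h1) (W.toSubmodule.smul_mem (pp N) h1)
    have heq : B N *ᵥ e₁ - pp N • e₁ = ss N • e₂ := by
      ext i; fin_cases i <;> simp [B_mulVec, e₁, e₂]
    rw [heq] at h
    exact (W.toSubmodule.smul_mem_iff (ss_ne_zero hN)).1 h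
  have h21 : e₂ ∈ W.toSubmodule → e₁ ∈ W.toSubmodule := fun h2 => by
    have h := W.toSubmodule.sub_mem (hB _ h2) (W.toSubmodule.smul_mem (uu N) h2)
    have heq : B N *ᵥ e₂ - uu N • e₂ = e₁ := by
      ext i; fin_cases i <;> simp [B_mulVec, e₁, e₂]
    rwa [heq] at h
  have he : e₁ ∈ W.toSubmodule ∧ e₂ ∈ W.toSubmodule := by
    by_cases h0 : v 0 = 0
    · have h1 : v 1 ≠ 0 := by
        intro h1; apply hv0; ext i; fin_cases i <;> simp [h0, h1]
      have heq : v = v 1 • e₂ := by ext i; fin_cases i <;> simp [e₂, h0]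
      have h2 : e₂ ∈ W.toSubmodule := (W.toSubmodule.smul_mem_iff h1).1 (heq ▸ hv)
      exact ⟨h21 h2, h2⟩
    · have h := W.toSubmodule.sub_mem (W.toSubmodule.smul_mem (Q N) hv) (hA _ hv)
      have heq : Q N • v - A N *ᵥ v = ((Q N - 1) * v 0) • e₁ := by
        ext i
        (fin_cases i <;> simp [A_mulVec, e₁]); ring
      rw [heq] at h
      have h1 : e₁ ∈ W.toSubmodule :=
        (W.toSubmodule.smul_mem_iff (mul_ne_zero (Q_sub_one_ne_zero hN) h0)).1 h
      exact ⟨h1, h12 h1⟩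
  rw [eq_top_iff]
  rintro w -
  have hw : w = w 0 • e₁ + w 1 • e₂ := by ext i; fin_cases i <;> simp [e₁, e₂]
  rw [hw]
  exact W.toSubmodule.add_mem (W.toSubmodule.smul_mem _ he.1) (W.toSubmodule.smul_mem _ he.2)

/-- `ρ_N` is semisimple for `N ≥ 1` (irreducible representations are). [folklore] -/
theorem isSemisimple_ρN {N : ℕ} (hN : 1 ≤ N) : (ρN N).toContinuousRep.IsSemisimple := by
  haveI := isIrreducible_ρN hN
  change ComplementedLattice (Subrepresentation (ρN N).toRepresentation)
  infer_instance

/-- `𝔉 = {a, b, ab}`. [folklore] -/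
def 𝔉 : Set Γ₀ := {a, b, a * b}

/-- `𝔉` is dense (every non-empty set is, for the indiscrete topology). [folklore] -/
theorem dense_𝔉 : Dense 𝔉 := dense_iff_inter_open.2 fun U hU hne => by
  rcases (TopologicalSpace.isOpen_top_iff U).1 hU with rfl | rfl
  · exact (Set.not_nonempty_empty hne).elim
  · exact ⟨a, Set.mem_univ _, by simp [𝔉]⟩

open Classical in
/-- `𝔈 = 𝔈¹ = 𝔈²`: `{-1}` at `ab`, `{1}` elsewhere (in particular at `a` and `b`). [folklore] -/
def 𝔈 (f : Γ₀) : Multiset k₀ := if f = a * b then {-1} else {1}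

/-- `𝔈(a) = {1}` (`a ≠ ab` as `b ≠ 1`). [folklore] -/
theorem 𝔈_a : 𝔈 a = {1} := if_neg fun h => FreeGroup.of_ne_one false (mul_eq_left.1 h.symm)

/-- `𝔈(b) = {1}` (`b ≠ ab` as `a ≠ 1`). [folklore] -/
theorem 𝔈_b : 𝔈 b = {1} := if_neg fun h => FreeGroup.of_ne_one true (mul_eq_right.1 h.symm)

/-- `𝔈(ab) = {-1}`. [folklore] -/
theorem 𝔈_ab : 𝔈 (a * b) = {-1} := if_pos rfl

/-- A unit of `k₀` whose value is a natural number `c > 1` has infinite order (characteristic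
`0`). [folklore] -/
theorem not_isOfFinOrder_of_val_eq_natCast {u : k₀ˣ} {c : ℕ} (hc : 1 < c) (hu : (u : k₀) = c) :
    ¬ IsOfFinOrder u := by
  intro h
  obtain ⟨n, hn, hn1⟩ := h.exists_pow_eq_one
  have h1 : ((c ^ n : ℕ) : k₀) = 1 := by
    rw [Nat.cast_pow, ← hu, ← Units.val_pow_eq_pow_val, hn1, Units.val_one]
  exact (Nat.one_lt_pow hn.ne' hc).ne' (Nat.cast_eq_one.1 h1)

/-- `↑(two ^ N) = Q`. [folklore] -/
theorem val_two_pow (N : ℕ) : (((two ^ N : k₀ˣ)) : k₀) = Q N := by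
  rw [Units.val_pow_eq_pow_val, val_two]; rfl

/-- `↑((two·two) ^ N) = Q²`. [folklore] -/
theorem val_two_mul_two_pow (N : ℕ) : ((((two * two) ^ N : k₀ˣ)) : k₀) = Q N ^ 2 := by
  rw [Units.val_pow_eq_pow_val, Units.val_mul, val_two, mul_pow, sq]; rfl

end Prop712Counterexample

open Prop712Counterexample in
/-- **The literal transcription `prop712` of HLTT Prop. 7.12 is false.**  Fed with the data of
`Prop712Counterexample` (`Γ₀ = F_2` and `k₀ = ℚ̄` indiscrete, `d = 1`, `𝔉 = {a, b, ab}`,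
`μ(a) = μ(b) = 2`, `𝔈`, `ℳ = ℤ_{>0}`, `ρ_m = ρN m`), all hypotheses of `prop712` hold, and its
conclusion yields `ρ¹ : Γ₀ → GL_1(k₀)` with `ρ¹(a)₀₀ = ρ¹(b)₀₀ = 1`, `ρ¹(ab)₀₀ = -1`, contradicting
multiplicativity.  The printed proof is fine for Hausdorff `k` (it uses this on p. 226, l. 8),
whence the corrected named fact `prop712Hausdorff`. [folklore] -/
theorem not_prop712 : ¬ prop712 := by
  intro h
  have hμ : ∀ f ∈ 𝔉, ¬ IsOfFinOrder (μ f) := by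
    intro f hf
    simp only [𝔉, Set.mem_insert_iff, Set.mem_singleton_iff] at hf
    rcases hf with rfl | rfl | rfl
    · exact not_isOfFinOrder_of_val_eq_natCast (c := 2) one_lt_two (by rw [a, μ_of, val_two]; simp)
    · exact not_isOfFinOrder_of_val_eq_natCast (c := 2) one_lt_two (by rw [b, μ_of, val_two]; simp)
    · exact not_isOfFinOrder_of_val_eq_natCast (c := 4) (by norm_num)
        (by rw [map_mul, a, b, μ_of, μ_of, Units.val_mul, val_two]; norm_num)
  have h𝔈 : ∀ f ∈ 𝔉, Multiset.card (𝔈 f) = 1 ∧ Multiset.card (𝔈 f) = 1 ∧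
      (0 : k₀) ∉ 𝔈 f ∧ (0 : k₀) ∉ 𝔈 f := by
    intro f _
    unfold 𝔈
    split_ifs <;> simp
  have hss : ∀ m ∈ Set.Ioi (0 : ℤ), (ρN m.toNat).toContinuousRep.IsSemisimple := by
    intro m hm
    obtain ⟨N, rfl⟩ := Int.eq_ofNat_of_zero_le (le_of_lt hm)
    rw [Int.toNat_natCast]
    exact isSemisimple_ρN (Int.natCast_pos.1 hm)
  have hρ : ∀ m ∈ Set.Ioi (0 : ℤ), ∀ f ∈ 𝔉,
      (FramedRep.charpoly (n := 2 * 1) (ρN m.toNat) f).roots =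
        𝔈 f + (𝔈 f).map (· * (((μ f) ^ m : k₀ˣ) : k₀)) := by
    intro m hm f hf
    obtain ⟨N, rfl⟩ := Int.eq_ofNat_of_zero_le (le_of_lt hm)
    have hN : 1 ≤ N := Int.natCast_pos.1 hm
    rw [zpow_natCast, Int.toNat_natCast]
    change ((ρN N f : GL (Fin 2) k₀) : Matrix (Fin 2) (Fin 2) k₀).charpoly.roots = _
    simp only [𝔉, Set.mem_insert_iff, Set.mem_singleton_iff] at hf
    rcases hf with rfl | rfl | rfl
    · rw [𝔈_a, a, μ_of, Multiset.map_singleton, one_mul, val_two_pow, ← a, ρN_a]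
      exact roots_charpoly_of_trace_of_det (trace_A N) (by rw [det_A, one_mul])
    · rw [𝔈_b, b, μ_of, Multiset.map_singleton, one_mul, val_two_pow, ← b, ρN_b]
      exact roots_charpoly_of_trace_of_det (trace_B N) (by rw [det_B, one_mul])
    · rw [𝔈_ab, map_mul μ, a, b, μ_of, μ_of, Multiset.map_singleton, val_two_mul_two_pow,
        neg_one_mul, ← a, ← b, map_mul (ρN N), Units.val_mul, ρN_a, ρN_b]
      exact roots_charpoly_of_trace_of_det (trace_AB hN) (det_AB N)
  obtain ⟨ρ₁, ρ₂, -, -, hF⟩ := h Γ₀ 𝔉 dense_𝔉 k₀ 1 one_pos μ hμ 𝔈 𝔈 h𝔈 (Set.Ioi 0)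
    (Set.Ioi_infinite 0) (fun m ↦ ρN m.toNat) hss hρ
  have ha := (hF a (by simp [𝔉])).1
  have hb := (hF b (by simp [𝔉])).1
  have hab := (hF (a * b) (by simp [𝔉])).1
  simp only [FramedRep.charpoly, roots_charpoly_fin_one, 𝔈_a, 𝔈_b, 𝔈_ab,
    Multiset.singleton_inj] at ha hb hab
  have hmul : ((ρ₁ (a * b) : GL (Fin 1) k₀) : Matrix (Fin 1) (Fin 1) k₀) 0 0 =
      ((ρ₁ a : GL (Fin 1) k₀) : Matrix (Fin 1) (Fin 1) k₀) 0 0 *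
        ((ρ₁ b : GL (Fin 1) k₀) : Matrix (Fin 1) (Fin 1) k₀) 0 0 := by
    rw [map_mul, Units.val_mul, Matrix.mul_apply, Fin.sum_univ_one]
  rw [ha, hb, hab] at hmul
  norm_num at hmul


/-! ### Discharge of the corrected named fact `prop712Hausdorff`

The proof is **not** the printed one (reductive Zariski closure `G` of `(μ ⊕ ⊕ ρ_m)(Γ)`, its
central torus `Z(G)⁰`, Lemma 7.1 – Cor. 7.11 of Harris–Lan–Taylor–Thorne, pp. 226–232 — linear
algebraic groups over `k` are not available in Mathlib) but an elementary replacement with the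
same conclusion, assembled in `TwistedSumAssembly`
(`TwistedSum.exists_framedRep_of_unbounded`): on the dense set `𝔉` the characters are
`tr ρ_m = s₁ + μᵐ s₂`, whence by continuity, density and Hausdorffness of `k` a *three-term
identity* of characters on `Γ` and, by Brauer–Nesbitt for semisimple representations
(`Literature/RepresentationTheory/Semisimple/EquivOfCharacter`), of representations; counting
multiplicities of the `μ`-power twists of irreducible constituents (Schur, Krull–Schmidt,
`Literature/RepresentationTheory/Semisimple/MultiplicityDecomposition`) turns this into the
combinatorial lemma `TwistedSum.exists_eq_add_shift` (`TwistedSumCombinatorics`), which yields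
`ρ_m ≃ A ⊕ B ⊗ μ^{m-m₀}` for all large `m ∈ ℳ` (`TwistedSumAlgebraic`); a generic-twist
argument (as in the uniqueness part of Cor. 7.3 of the source) identifies the characteristic
roots of `A` and `B ⊗ μ^{-m₀}` on `𝔉` with `𝔈¹`, `𝔈²`, and framing these two continuous
semisimple subrepresentations gives `ρ¹`, `ρ²`.  The case of `ℳ` unbounded below is reduced to
the unbounded-above case by `μ ↦ μ⁻¹`, `ℳ ↦ -ℳ`. -/

/-- **Harris–Lan–Taylor–Thorne 2016, Prop. 7.12 (corrected: `k` Hausdorff) holds.**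
Discharge of the named fact `prop712Hausdorff` (statement unchanged): for `Γ` a topological
group, `𝔉 ⊆ Γ` dense, `k` an algebraically closed Hausdorff topological field of characteristic
`0`, `d ≥ 1`, `μ : Γ → kˣ` continuous with `μ(f)` of infinite order (`f ∈ 𝔉`), `d`-element
multisets `𝔈ⁱ_f` of non-zero elements, `ℳ ⊆ ℤ` infinite and continuous semisimple
`ρ_m : Γ → GL_{2d}(k)` (`m ∈ ℳ`) with characteristic roots `𝔈¹_f ⊔ 𝔈²_f μ(f)ᵐ` at every
`f ∈ 𝔉`, there are continuous semisimple `ρ¹, ρ² : Γ → GL_d(k)` with characteristic roots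
`𝔈¹_f`, `𝔈²_f` at every `f ∈ 𝔉`.  Our proof (module docstring above and `TwistedSumAssembly`)
replaces the algebraic-group argument of the source by character theory and combinatorics.
[cite: HarrisLanTaylorThorneRMS2016, Prop. 7.12 (p. 232), setting p. 225, proof pp. 226–232] -/
theorem prop712Hausdorff_holds : prop712Hausdorff := by
  intro Γ _ _ _ 𝔉 h𝔉 k _ _ _ _ _ _ d _ μ hμ 𝔈₁ 𝔈₂ h𝔈 ℳ hℳ ρ hss hρ
  by_cases hup : ∀ N : ℤ, ∃ m ∈ ℳ, N ≤ m
  · exact TwistedSum.exists_framedRep_of_unbounded 𝔉 h𝔉 d μ hμ 𝔈₁ 𝔈₂ h𝔈 ℳ hup ρ hss hρ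
  · -- `ℳ` is bounded above, hence (being infinite) unbounded below: pass to `-ℳ` and `μ⁻¹`
    push Not at hup
    obtain ⟨N, hN⟩ := hup
    have hdown : ∀ N' : ℤ, ∃ m ∈ ℳ, m ≤ N' := by
      intro N'
      by_contra h
      push Not at h
      exact hℳ ((Set.finite_Ioo N' N).subset fun m hm => ⟨h m hm, hN m hm⟩)
    have hℳ' : ∀ N' : ℤ, ∃ m ∈ {m : ℤ | -m ∈ ℳ}, N' ≤ m := by
      intro N'
      obtain ⟨m, hm, hmN⟩ := hdown (-N')
      exact ⟨-m, by simpa using hm, by omega⟩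
    have hμinv : ∀ f, (μ⁻¹ : Γ →ₜ* kˣ) f = (μ f)⁻¹ := fun f => rfl
    have hμ' : ∀ f ∈ 𝔉, ¬ IsOfFinOrder ((μ⁻¹ : Γ →ₜ* kˣ) f) := fun f hf => by
      rw [hμinv, isOfFinOrder_inv_iff]
      exact hμ f hf
    have hss' : ∀ m ∈ {m : ℤ | -m ∈ ℳ}, (ρ (-m)).toContinuousRep.IsSemisimple :=
      fun m hm => hss (-m) hm
    have hρ' : ∀ m ∈ {m : ℤ | -m ∈ ℳ}, ∀ f ∈ 𝔉, (FramedRep.charpoly (ρ (-m)) f).roots =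
        𝔈₁ f + (𝔈₂ f).map (· * ((((μ⁻¹ : Γ →ₜ* kˣ) f) ^ m : kˣ) : k)) := by
      intro m hm f hf
      rw [hρ (-m) hm f hf, hμinv, inv_zpow']
    exact TwistedSum.exists_framedRep_of_unbounded 𝔉 h𝔉 d μ⁻¹ hμ' 𝔈₁ 𝔈₂ h𝔈 _ hℳ'
      (fun m => ρ (-m)) hss' hρ'

end Literature.NumberTheory.GaloisRepresentations.HarrisLanTaylorThorne2016
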